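import Summits.CriticalPhenomena.PercolationContinuityZ3.Theses.PercNonProliferation
import Summits.CriticalPhenomena.PercolationContinuityZ3.Theorems.PercNonProliferationNonProliferationRatioDichotomy
import Summits.CriticalPhenomena.PercolationContinuityZ3.Theorems.PercNonProliferationNonProliferationStubSubshellCrossers
import Summits.CriticalPhenomena.PercolationContinuityZ3.Theorems.PercNonProliferationNonProliferationStubDisjointShellsIndep
import Summits.CriticalPhenomena.PercolationContinuityZ3.Theorems.PercNonProliferationNonProliferationStubShellOfBoxCrossers
import Literature.Probability.Percolation.RSW
import HarnessLib

/-!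
# Crux `PercNonProliferation.NonProliferation` (stmt-CriticalPhenomena-4444), line `avoidance-cost-covering`:
# the ONE-RATIO THREE-CROSSER CRITERION implies the crux (sixth socket)

Lead file of line `avoidance-cost-covering` (skeleton `Cruxes/NonProliferation/Lines/avoidance_cost_covering.lean`).
With the three provable stubs of the line landed (`stub_subshellCrossers` p129292,
`stub_disjointShellsIndep` p129213, `stub_shellOfBoxCrossers` p129273) the line's composition
`NonProliferation_of` becomes an unconditional reduction of the crux to its single open stub
`stub_oneRatioThreeCrossers`, recorded here by name as
`nonProliferation_of_oneRatioThreeCrossers : stub_oneRatioThreeCrossers-signature → NonProliferation`.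

Write `Sh(a, c) := {v ∈ B(c) | ∃ l, a ≤ |v l|}` (closed shell `a ≤ ‖v‖∞ ≤ c` of `ℤ³`) and
`E₃(a, c)` for the event "three points of `B(a)`, each joined INSIDE `Sh(a, c)` to `∂ⁱⁿB(c)`,
pairwise not joined inside `Sh(a, c)`" (three shell-distinct crossers). The criterion:
`∃ k₀ ≥ 2, a₀ ≥ 1, q` with `(k₀+1)² q < 1` and `P_{p_c}(E₃(a, k₀ a)) ≤ q` for every `a ≥ a₀`.

Proof (the avoidance-cost bootstrap, Aizenman 1997 §5 / ACHS 2021 Thm 3.1 template; here for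
Bernoulli percolation with independent disjoint shells):
* `real_shellThree_submult`: for `a ≤ b < b' ≤ c`, `P(E₃(a,c)) ≤ P(E₃(a,b)) · P(E₃(b',c))` — a.s.
  `ω ⊆ E(ℤ³)` (`ae_subset_edgeSet`), restriction of crossers to the two sub-shells
  (`stub_subshellCrossers`) and independence of disjoint shells (`stub_disjointShellsIndep`).
* `ladder_of_submult` (abstract, any nonnegative doubly-indexed `P` with that submultiplicativity):
  `P(a, k₀ a) ≤ q ∀ a ≥ a₀` gives `P(a, k₀ (k₀+1)^j a) ≤ q^{j+1}` — the shells
  `Sh((k₀+1)^i a, k₀ (k₀+1)^i a)`, `i ≤ j`, are nested and pairwise vertex-disjoint.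
* choose `j` with `726 k₀² q ((k₀+1)² q)^j ≤ 1/2` (`exists_pow_lt_of_lt_one`), read box
  three-crossers of `B(k m) ∖ B(m)`, `k = k₀ (k₀+1)^j`, as shell three-crossers
  (`stub_shellOfBoxCrossers`, a.s.), and feed `726 k² P ≤ 1/2` for all `m ≥ a₀` into the landed
  mid-sphere covering socket `nonProliferation_of_frequently_multiCross` (p124993).

No exponent is assumed: the decay rate in the ratio is generated by the ladder; the `d = 3` content
is the single finite-ratio inequality in the hypothesis (false for `d ≥ 7` under (t-c):
`Negative.nonProliferation_false_without_dimThree`, `…ThreeCrosserDecayAboveSix` p124280).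
-/

noncomputable section

namespace Summit.CriticalPhenomena.PercolationContinuityZ3.Theorems.NonProliferation

open MeasureTheory Filter Topology
open Literature.Probability.LatticeModels Literature.Probability.Percolation

/-- The closed shell `Sh(a, c) = {v ∈ B(c) | ∃ l, a ≤ |v l|}` of `ℤ³` (local notation only). -/
local notation3 "Sh⟦" a ", " c "⟧" =>
  ({v : Site 3 | v ∈ box 3 c ∧ ∃ l : Fin 3, ((a : ℕ) : ℤ) ≤ |v l|} : Set (Site 3))

/-- The shell three-crosser event `E₃(a, c)` of `ℤ³` (local notation only). -/
local notation3 "E₃⟦" a ", " c "⟧" =>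
  ({ω : BondConfig (Site 3) | ∃ x : Fin (2 + 1) → Site 3, (∀ i, x i ∈ box 3 a) ∧
    (∀ i, ∃ y ∈ innerBoundary (zdGraph 3) (box 3 c), ω ∈ openConnIn Sh⟦a, c⟧ (x i) y) ∧
    ∀ i j, i ≠ j → ω ∉ openConnIn Sh⟦a, c⟧ (x i) (x j)} : Set (BondConfig (Site 3)))

namespace OneRatioThreeCrossers

/-- **The ladder, abstractly.** A nonnegative doubly-indexed quantity `P a c` which is
submultiplicative over a cut `a ≤ b < b' ≤ c` (`P a c ≤ P a b · P b' c`) and satisfies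
`P a (k₀ a) ≤ q` for all `a ≥ a₀ ≥ 1` (`k₀ ≥ 1`) satisfies `P a (k₀ (k₀+1)^j a) ≤ q^{j+1}` for
all `j` and all `a ≥ a₀`: induction on `j`, cutting `Sh(a, k₀(k₀+1)^{j+1} a)` at
`b = k₀ (k₀+1)^j a < b' = (k₀+1)^{j+1} a`. -/
theorem ladder_of_submult {P : ℕ → ℕ → ℝ} (hP0 : ∀ a c, 0 ≤ P a c)
    (hsub : ∀ a b b' c : ℕ, a ≤ b → b < b' → b' ≤ c → P a c ≤ P a b * P b' c)
    {k₀ a₀ : ℕ} {q : ℝ} (hk₀ : 1 ≤ k₀) (ha₀ : 1 ≤ a₀)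
    (hcrit : ∀ a : ℕ, a₀ ≤ a → P a (k₀ * a) ≤ q) :
    ∀ j a : ℕ, a₀ ≤ a → P a (k₀ * (k₀ + 1) ^ j * a) ≤ q ^ (j + 1) := by
  have hq0 : 0 ≤ q := le_trans (hP0 _ _) (hcrit a₀ le_rfl)
  intro j
  induction j with
  | zero =>
    intro a ha
    simpa only [pow_zero, mul_one, pow_one, zero_add] using hcrit a ha
  | succ j ih =>
    intro a ha
    have ha1 : 1 ≤ a := le_trans ha₀ ha
    have hpos : 0 < k₀ * (k₀ + 1) ^ j := Nat.mul_pos (by omega) (by positivity)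
    have hab : a ≤ k₀ * (k₀ + 1) ^ j * a := Nat.le_mul_of_pos_left a hpos
    have hbb' : k₀ * (k₀ + 1) ^ j * a < (k₀ + 1) ^ (j + 1) * a := by
      have hpos' : 0 < (k₀ + 1) ^ j * a := Nat.mul_pos (by positivity) (by omega)
      calc k₀ * (k₀ + 1) ^ j * a < k₀ * (k₀ + 1) ^ j * a + (k₀ + 1) ^ j * a :=
            Nat.lt_add_of_pos_right hpos'
        _ = (k₀ + 1) ^ (j + 1) * a := by ring
    have hb'c : (k₀ + 1) ^ (j + 1) * a ≤ k₀ * (k₀ + 1) ^ (j + 1) * a := by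
      rw [mul_assoc]
      exact Nat.le_mul_of_pos_left _ (by omega)
    have hstep := hsub a (k₀ * (k₀ + 1) ^ j * a) ((k₀ + 1) ^ (j + 1) * a)
      (k₀ * (k₀ + 1) ^ (j + 1) * a) hab hbb' hb'c
    have hnew : P ((k₀ + 1) ^ (j + 1) * a) (k₀ * (k₀ + 1) ^ (j + 1) * a) ≤ q := by
      have h := hcrit ((k₀ + 1) ^ (j + 1) * a) (le_trans ha (Nat.le_mul_of_pos_left a (by positivity)))
      rwa [← mul_assoc] at h
    calc P a (k₀ * (k₀ + 1) ^ (j + 1) * a)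
        ≤ P a (k₀ * (k₀ + 1) ^ j * a) * P ((k₀ + 1) ^ (j + 1) * a) (k₀ * (k₀ + 1) ^ (j + 1) * a) :=
          hstep
      _ ≤ q ^ (j + 1) * q := mul_le_mul (ih a ha) hnew (hP0 _ _) (pow_nonneg hq0 _)
      _ = q ^ (j + 1 + 1) := by ring

/-- **Choice of the number of shells.** For `A ≥ 0` and `0 ≤ t < 1` there is `j` with
`A t^j ≤ 1/2` (`exists_pow_lt_of_lt_one` with `ε = 1 / (2 (A + 1))`). -/
theorem exists_mul_pow_le_half {A t : ℝ} (hA : 0 ≤ A) (ht0 : 0 ≤ t) (ht1 : t < 1) :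
    ∃ j : ℕ, A * t ^ j ≤ 1 / 2 := by
  obtain ⟨j, hj⟩ := exists_pow_lt_of_lt_one (show (0 : ℝ) < 1 / (2 * (A + 1)) by positivity) ht1
  refine ⟨j, ?_⟩
  have h1 : A * t ^ j ≤ A * (1 / (2 * (A + 1))) := mul_le_mul_of_nonneg_left hj.le hA
  have h2 : A * (1 / (2 * (A + 1))) ≤ 1 / 2 := by
    rw [mul_one_div, div_le_iff₀ (by positivity)]
    nlinarith
  have _ := ht0
  exact h1.trans h2

/-- **Shell submultiplicativity of the three-crosser probability** (every `p`): for
`a ≤ b < b' ≤ c`, `P_p(E₃(a,c)) ≤ P_p(E₃(a,b)) · P_p(E₃(b',c))`. Almost every configuration uses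
lattice edges only (`ae_subset_edgeSet`); on those, three shell-distinct crossers of `Sh(a,c)`
restrict to three of `Sh(a,b)` and three of `Sh(b',c)` (`stub_subshellCrossers`); the two shell
events are independent (`stub_disjointShellsIndep`, `b < b'`). -/
theorem real_shellThree_submult (p : unitInterval) {a b b' c : ℕ} (hab : a ≤ b) (hbb' : b < b')
    (hb'c : b' ≤ c) :
    (bondPercolation (zdGraph 3) p).real E₃⟦a, c⟧ ≤
      (bondPercolation (zdGraph 3) p).real E₃⟦a, b⟧ * (bondPercolation (zdGraph 3) p).real E₃⟦b', c⟧ := by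
  have hincl : ∀ᵐ ω ∂(bondPercolation (zdGraph 3) p), ω ∈ E₃⟦a, c⟧ → ω ∈ E₃⟦a, b⟧ ∩ E₃⟦b', c⟧ := by
    filter_upwards [ae_subset_edgeSet (zdGraph 3) p] with ω hω hmem
    exact stub_subshellCrossers 3 2 a b b' c ω hab (by omega) (by omega) hb'c hω hmem
  calc (bondPercolation (zdGraph 3) p).real E₃⟦a, c⟧
      ≤ (bondPercolation (zdGraph 3) p).real (E₃⟦a, b⟧ ∩ E₃⟦b', c⟧) := by
        simp only [measureReal_def]
        exact ENNReal.toReal_mono (measure_ne_top _ _) (measure_mono_ae hincl)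
    _ ≤ _ := stub_disjointShellsIndep 3 2 a b b' c p hbb'

/-- **The ladder for the critical shell three-crosser probability**: if
`P_{p_c}(E₃(a, k₀ a)) ≤ q` for all `a ≥ a₀ ≥ 1` (`k₀ ≥ 1`), then
`P_{p_c}(E₃(a, k₀ (k₀+1)^j a)) ≤ q^{j+1}` for all `j` and `a ≥ a₀`. -/
theorem real_shellThree_ladder {k₀ a₀ : ℕ} {q : ℝ} (hk₀ : 1 ≤ k₀) (ha₀ : 1 ≤ a₀)
    (hcrit : ∀ a : ℕ, a₀ ≤ a →
      (bondPercolation (zdGraph 3) (criticalProbI 3)).real E₃⟦a, k₀ * a⟧ ≤ q) :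
    ∀ j a : ℕ, a₀ ≤ a →
      (bondPercolation (zdGraph 3) (criticalProbI 3)).real E₃⟦a, k₀ * (k₀ + 1) ^ j * a⟧ ≤
        q ^ (j + 1) :=
  ladder_of_submult (P := fun a c => (bondPercolation (zdGraph 3) (criticalProbI 3)).real E₃⟦a, c⟧)
    (fun _ _ => measureReal_nonneg)
    (fun _ _ _ _ hab hbb' hb'c => real_shellThree_submult (criticalProbI 3) hab hbb' hb'c)
    hk₀ ha₀ hcrit

end OneRatioThreeCrossers

open OneRatioThreeCrossers in
/-- **The one-ratio three-crosser criterion implies the crux** (line `avoidance-cost-covering`,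
composition with its three landed stubs inlined): if there are `k₀ ≥ 2`, `a₀ ≥ 1` and `q` with
`(k₀+1)² q < 1` such that for every `a ≥ a₀` the critical probability of three shell-distinct
crossers of `Sh(a, k₀ a)` is at most `q`, then `NonProliferation` holds. The ladder gives
`P(E₃(m, k m)) ≤ q^{j+1}` at `k = k₀ (k₀+1)^j`; box three-crossers are shell three-crossers a.s.
(`stub_shellOfBoxCrossers`); with `726 k₀² q ((k₀+1)² q)^j ≤ 1/2` the mid-sphere covering socket
`nonProliferation_of_frequently_multiCross` closes the crux (`M = 2 · 726 k²`, `c = 1/2`). -/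
theorem nonProliferation_of_oneRatioThreeCrossers :
    (∃ k₀ a₀ : ℕ, ∃ q : ℝ, 2 ≤ k₀ ∧ 1 ≤ a₀ ∧ ((k₀ : ℝ) + 1) ^ 2 * q < 1 ∧ ∀ a : ℕ, a₀ ≤ a →
      (bondPercolation (zdGraph 3) (criticalProbI 3)).real
        {ω | ∃ x : Fin (2 + 1) → Site 3, (∀ i, x i ∈ box 3 a) ∧
          (∀ i, ∃ y ∈ innerBoundary (zdGraph 3) (box 3 (k₀ * a)),
            ω ∈ openConnIn {v : Site 3 | v ∈ box 3 (k₀ * a) ∧ ∃ l : Fin 3, (a : ℤ) ≤ |v l|} (x i) y) ∧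
          ∀ i j, i ≠ j →
            ω ∉ openConnIn {v : Site 3 | v ∈ box 3 (k₀ * a) ∧ ∃ l : Fin 3, (a : ℤ) ≤ |v l|} (x i) (x j)}
        ≤ q) →
    Summit.CriticalPhenomena.PercolationContinuityZ3.Theses.PercNonProliferation.NonProliferation := by
  rintro ⟨k₀, a₀, q, hk₀, ha₀, hθ, hcrit⟩
  set μ : Measure (BondConfig (Site 3)) := bondPercolation (zdGraph 3) (criticalProbI 3) with hμ
  have hq0 : 0 ≤ q := le_trans measureReal_nonneg (hcrit a₀ le_rfl)
  have hlad := real_shellThree_ladder (q := q) (show 1 ≤ k₀ by omega) ha₀ hcrit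
  -- the base `t = (k₀+1)² q ∈ [0,1)` and the number of shells `j`
  set t : ℝ := ((k₀ : ℝ) + 1) ^ 2 * q with ht
  have ht0 : 0 ≤ t := by positivity
  set A : ℝ := 726 * (k₀ : ℝ) ^ 2 * q with hA
  have hA0 : 0 ≤ A := by positivity
  obtain ⟨j, hjA⟩ := exists_mul_pow_le_half hA0 ht0 hθ
  -- the ratio `k = k₀ (k₀+1)^j ≥ 2`
  have hK : 1 ≤ (k₀ + 1) ^ j := Nat.one_le_pow _ _ (by omega)
  have hk2 : 2 ≤ k₀ * (k₀ + 1) ^ j :=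
    calc 2 ≤ k₀ := hk₀
      _ = k₀ * 1 := (mul_one _).symm
      _ ≤ k₀ * (k₀ + 1) ^ j := Nat.mul_le_mul_left _ hK
  refine nonProliferation_of_frequently_multiCross ⟨k₀ * (k₀ + 1) ^ j, 2, hk2, Eventually.frequently ?_⟩
  filter_upwards [eventually_ge_atTop a₀] with m hm
  have hmL : m ≤ k₀ * (k₀ + 1) ^ j * m := Nat.le_mul_of_pos_left m (Nat.mul_pos (by omega) (by positivity))
  -- box three-crossers are shell three-crossers (a.e.), then the ladder
  have hincl : ∀ᵐ ω ∂μ,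
      ω ∈ {ω | ∃ x : Fin (2 + 1) → Site 3, (∀ i, x i ∈ box 3 m) ∧
        (∀ i, ∃ y ∈ innerBoundary (zdGraph 3) (box 3 (k₀ * (k₀ + 1) ^ j * m)),
          ω ∈ openConnIn (↑(box 3 (k₀ * (k₀ + 1) ^ j * m)) : Set (Site 3)) (x i) y) ∧
        ∀ i j', i ≠ j' → ω ∉ openConnIn (↑(box 3 (k₀ * (k₀ + 1) ^ j * m)) : Set (Site 3)) (x i) (x j')} →
      ω ∈ E₃⟦m, k₀ * (k₀ + 1) ^ j * m⟧ := by
    filter_upwards [ae_subset_edgeSet (zdGraph 3) (criticalProbI 3)] with ω hω hmem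
    exact stub_shellOfBoxCrossers 3 2 m _ ω hmL hω hmem
  have hbox : μ.real {ω | ∃ x : Fin (2 + 1) → Site 3, (∀ i, x i ∈ box 3 m) ∧
        (∀ i, ∃ y ∈ innerBoundary (zdGraph 3) (box 3 (k₀ * (k₀ + 1) ^ j * m)),
          ω ∈ openConnIn (↑(box 3 (k₀ * (k₀ + 1) ^ j * m)) : Set (Site 3)) (x i) y) ∧
        ∀ i j', i ≠ j' → ω ∉ openConnIn (↑(box 3 (k₀ * (k₀ + 1) ^ j * m)) : Set (Site 3)) (x i) (x j')}
      ≤ q ^ (j + 1) := by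
    calc _ ≤ μ.real E₃⟦m, k₀ * (k₀ + 1) ^ j * m⟧ := by
          simp only [measureReal_def]
          exact ENNReal.toReal_mono (measure_ne_top _ _) (measure_mono_ae hincl)
      _ ≤ q ^ (j + 1) := hlad j m hm
  -- arithmetic: 726 (k₀ (k₀+1)^j)² q^{j+1} = A t^j ≤ 1/2
  have hcast : ((k₀ * (k₀ + 1) ^ j : ℕ) : ℝ) = (k₀ : ℝ) * ((k₀ : ℝ) + 1) ^ j := by push_cast; ring
  have halg : 726 * ((k₀ : ℝ) * ((k₀ : ℝ) + 1) ^ j) ^ 2 * q ^ (j + 1) = A * t ^ j := by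
    rw [hA, ht]
    generalize ((k₀ : ℝ) + 1) = K
    ring
  calc 726 * ((k₀ * (k₀ + 1) ^ j : ℕ) : ℝ) ^ 2 * μ.real _
      ≤ 726 * ((k₀ * (k₀ + 1) ^ j : ℕ) : ℝ) ^ 2 * q ^ (j + 1) := by gcongr
    _ = 726 * ((k₀ : ℝ) * ((k₀ : ℝ) + 1) ^ j) ^ 2 * q ^ (j + 1) := by rw [hcast]
    _ = A * t ^ j := halg
    _ ≤ 1 / 2 := hjA

end Summit.CriticalPhenomena.PercolationContinuityZ3.Theorems.NonProliferation

end
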